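import Summits.QuantumFields.YangMills.Theorems.BalabanUVNodesN15SiteColouredWords
import Summits.QuantumFields.YangMills.Theorems.BalabanUVNodesN15SiteScalarLayerDressedSizedF
import HarnessLib

/-!
# Route «BalabanUVNodes», cluster K4 «SpineRates» — node N15 = NE2: THE SITE LAYER WITH THE BACKGROUND LIVE IN THE TwoGrid ENTRY CURRENCY, XXV — THE COLOURED (3.65) WORDS WITH THE
# AVERAGING SPECIES LIVE: `(Q + F₂)X²(Q* + F₂*) − QG²Q*` over the COLOURED unit-torus sites `Tor M × ι`, size and two-grid letters from block letters (dag-n15-c S2 at `blkY := fst`), and the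
# three letters of part XXI's coloured socket from a dressed coloured layer's block letters AND a coloured averaging species' six letters, READ AT SIZE — part VI on the coloured carrier

Cell `pub-ymgap`, WIDTH SEAT `pub-ymgap-dag-n15-w1` (generation 3; director-ym №197 ∕ HUMAN RULING D-0149; chair R455 (A) ∕ R461; plan g83 `W-SEAT-START-LIST.md` v11 §n15; (αγ) step 1).
`bears_on: R4∕N15 · K3⁷ SpineGivenEndpointR13SepCoPH (stmt-QuantumFields-20544)`.  Filed `--supports stmt-QuantumFields-20544 --as helper` — COUNT-NEUTRAL.  One plumbing `def` (`sitePertCF`),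
the rest theorems; 0 `sorry`.  Imports BY NAME this seat's part XXII `…N15SiteColouredWords` (`sitePertC`, `siteEntriesC`, `abs_siteEntriesC_le_of_hasMaj`, `siteForm_zero_zero'`, part XVIII
`sitePertF_sizeConst_le` ∕ `sitePertF_fitConst_le` through part XI? — no: those two live in part XVIII `…SiteScalarLayerDressedSizedF`, imported here) and dag-n15-c S2 (`hasMaj_siteC`,
`hasMaj_idef_siteForm`, generic in the blocks); nothing in the tree is modified.

WHY.  Part XXII dropped the averaging species on the coloured road (as part V did on the scalar road); part VI put it back on the scalar road.  THIS FILE is part VI on the coloured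
carrier, AT SIZE: the words `siteForm q F Fs X − siteForm₀ q G` with coloured averaging species `F : (Xc → ℝ) → (Tor M × ι → ℝ)`, `Fs` reverse, their size ∕ two-grid letters
(S2, `blkY := fst`), and the sized three-letter package for part XXI's socket — the corner a coloured F₂-live family (sequel) needs.

CONTENTS.  §1 `sitePertCF` (+ `_zero_zero`), ★ `hasMaj_sitePertCF`, `sitePertCF_sub`, ★ `hasMaj_sitePertCF_sub`; §2 ★★ `siteLettersCF_of_sizedDressedLetters`.

HONEST FRAMING.  Count-neutral words ∕ bookkeeping; no new estimate; the averaging species is a BINDER here (six displayed letters).  NOT [B9] Thm 3.2 at a general (3.35)-regular `U`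
(NE2⁺ NOT PRINTED as an η-rate); Node 00's [B9] layers of record are residual — **N15 is NOT discharged** (typed 28∕28 · discharged 5∕27 of record unchanged); K3⁷ OPEN, its N15 pin
untouched; one finite four-torus programme at fixed `ε` — NOT ℝ⁴, NOT infinite volume, NOT OS, NOT a mass gap, NOT Clay; R4 closes the conditional finite-𝕋⁴ rung `BalabanLadder.UV` only.
Restate-immune.
-/

set_option autoImplicit false

noncomputable section

open scoped BigOperators Matrix
open Finset

namespace Summit.QuantumFields.YangMills.BalabanUVNodes.N15.SiteLayerBg

open Literature.MathematicalPhysics.QuantumFieldTheory.Balaban1983to89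
open Literature.MathematicalPhysics.QuantumFieldTheory.Balaban1983to89.B11SectG (BlockNorm HasMaj RowSum hasMaj_zero)
open Literature.MathematicalPhysics.QuantumFieldTheory.Balaban1983to89.T4EtaRateDefect (idef)
open Literature.MathematicalPhysics.QuantumFieldTheory.Balaban1983to89.T4EtaRateDefectSite (entry entry_le_of_hasMaj)
open Literature.MathematicalPhysics.QuantumFieldTheory.Balaban1983to89.T4EtaRateCoeffDefect (pull diagK diagK_nonneg fibre)
open Literature.MathematicalPhysics.QuantumFieldTheory.Balaban1983to89.B5Prop11Plancherel (Tor fine)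
open Literature.MathematicalPhysics.QuantumFieldTheory.Balaban1983to89.B4Sect5Torus (tdist)
open Literature.MathematicalPhysics.QuantumFieldTheory.Balaban1983to89.B4Sect5Proof (latticeConst latticeConst_nonneg)
open Literature.MathematicalPhysics.QuantumFieldTheory.Balaban1983to89.B5QGGQ145Bounds (Idx)
open Literature.MathematicalPhysics.QuantumFieldTheory.Balaban1983to89.B5PBridgeProjection (torIdx)
open Literature.MathematicalPhysics.QuantumFieldTheory.Balaban1983to89.B6UnitTorusCarrier (triangle254_unitTorusGeo rowSum_unitTorusGeo)
open Literature.MathematicalPhysics.QuantumFieldTheory.King1986.Torus (tdistT tdistT_nonneg)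
open Summit.QuantumFields.YangMills.BalabanUVNodes.N15.VectorPiece (unitTorusGeoS unitTorusGeoS_dist)
open Summit.QuantumFields.YangMills.BalabanUVNodes.N15.TwoGrid (tdistT_eq_tdist_torIdx)
open Summit.QuantumFields.YangMills.BalabanUVNodes.N15.SiteLayer (siteForm siteForm₀ hasMaj_siteC hasMaj_idef_siteForm)

variable {d : ℕ} {L : ℕ}

/-! ## §1 The coloured (3.65) words with the averaging species live and their two block letters -/

section WordsCF

variable {Xc : Type} [Fintype Xc] (M : Fin (d + 1) → ℕ) (ι : Type) [DecidableEq ι]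

/-- **THE SITE PERTURBATION OF (3.65), AVERAGING SPECIES LIVE**: `siteForm q F Fs X − siteForm₀ q G = F X²(Q* + Fs) + Q X² Fs + Q(X(X − G) + (X − G)G)Q*` (dag-n15-c S2
`siteForm_sub_siteForm₀`) — `F = Q′(U′U) − Q′`, `Fs = Q′*(U′U) − Q′*`. [cite: Balaban1985BackgroundPropagators, (3.58) p.402, (3.65) p.403 (shape)] -/
def sitePertCF (q : Xc → Tor M × ι) (F : (Xc → ℝ) →ₗ[ℝ] (Tor M × ι → ℝ)) (Fs : (Tor M × ι → ℝ) →ₗ[ℝ] (Xc → ℝ)) (G Xo : (Xc → ℝ) →ₗ[ℝ] (Xc → ℝ)) : (Tor M × ι → ℝ) →ₗ[ℝ] (Tor M × ι → ℝ) :=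
  siteForm q F Fs Xo - siteForm₀ q G

/-- At `F = Fs = 0` the full words are part V's. [folklore] -/
theorem sitePertCF_zero_zero (q : Xc → Tor M × ι) (G Xo : (Xc → ℝ) →ₗ[ℝ] (Xc → ℝ)) : sitePertCF M ι q 0 0 G Xo = sitePertC M ι q G Xo := rfl

/-- ★ **THE SIZE LETTER, SPECIES LIVE** (S2 `hasMaj_siteC`): from `X ≤ B·e^{−δd}`, `G ≤ β·e^{−δd}`, `X − G ≤ ε·e^{−δd}`, `F, Fs ≤ diagK r` (`B, β, ε, r ≥ 0`, `δ > 0`):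
`sitePertCF ≤ (r·B²(1 + r) + B²r + (B + β)ε)·c_δ·e^{−(δ∕2)d}` between the sharp site norms of `unitTorusGeoS L k M M_sz`. [cite: Balaban1985BackgroundPropagators, (3.66) p.403 (shape)] -/
theorem hasMaj_sitePertCF [NeZero L] [∀ μ, NeZero (M μ)] [Fintype ι] (k : ℕ) (Msz : ℝ) (q : Xc → Tor M × ι) {F : (Xc → ℝ) →ₗ[ℝ] (Tor M × ι → ℝ)} {Fs : (Tor M × ι → ℝ) →ₗ[ℝ] (Xc → ℝ)}
    {G Xo : (Xc → ℝ) →ₗ[ℝ] (Xc → ℝ)} {B β ε r δ : ℝ} (hB : 0 ≤ B) (hβ : 0 ≤ β) (hε : 0 ≤ ε) (hr : 0 ≤ r) (hδ : 0 < δ)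
    (hX : HasMaj (BlockNorm.ofBlocks (unitTorusGeoS L k M Msz) (fun x => (q x).1)) (BlockNorm.ofBlocks (unitTorusGeoS L k M Msz) (fun x => (q x).1)) Xo
      (fun y y' => B * Real.exp (-(δ * (unitTorusGeoS L k M Msz).dist y y'))))
    (hG : HasMaj (BlockNorm.ofBlocks (unitTorusGeoS L k M Msz) (fun x => (q x).1)) (BlockNorm.ofBlocks (unitTorusGeoS L k M Msz) (fun x => (q x).1)) G
      (fun y y' => β * Real.exp (-(δ * (unitTorusGeoS L k M Msz).dist y y'))))
    (hE : HasMaj (BlockNorm.ofBlocks (unitTorusGeoS L k M Msz) (fun x => (q x).1)) (BlockNorm.ofBlocks (unitTorusGeoS L k M Msz) (fun x => (q x).1)) (Xo - G)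
      (fun y y' => ε * Real.exp (-(δ * (unitTorusGeoS L k M Msz).dist y y'))))
    (hF : HasMaj (BlockNorm.ofBlocks (unitTorusGeoS L k M Msz) (fun x => (q x).1)) (BlockNorm.ofBlocks (unitTorusGeoS L k M Msz) (fun p : Tor M × ι => p.1)) F (diagK fun _ => r))
    (hFs : HasMaj (BlockNorm.ofBlocks (unitTorusGeoS L k M Msz) (fun p : Tor M × ι => p.1)) (BlockNorm.ofBlocks (unitTorusGeoS L k M Msz) (fun x => (q x).1)) Fs (diagK fun _ => r)) :
    HasMaj (BlockNorm.ofBlocks (unitTorusGeoS L k M Msz) (fun p : Tor M × ι => p.1)) (BlockNorm.ofBlocks (unitTorusGeoS L k M Msz) (fun p : Tor M × ι => p.1)) (sitePertCF M ι q F Fs G Xo)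
      (fun y y' => (r * (B * B * (1 + r)) + B * B * r + (B + β) * ε) * latticeConst (d + 1) (δ / 2) * Real.exp (-(δ / 2 * (unitTorusGeoS L k M Msz).dist y y'))) := by
  have hK : 0 ≤ latticeConst (d + 1) (δ / 2) := latticeConst_nonneg _ (by positivity)
  exact hasMaj_siteC (g := unitTorusGeoS L k M Msz) (σ := δ / 2) (cr := latticeConst (d + 1) (δ / 2)) (triangle254_unitTorusGeo L k M)
    (fun a b => tdistT_nonneg M a b) (rowSum_unitTorusGeo L k M (half_pos hδ)) (by positivity) hK (fun x => (q x).1) (fun p : Tor M × ι => p.1) q (fun _ => rfl)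
    hB hβ hε hr (by positivity : (0 : ℝ) ≤ δ / 2) (by linarith) hX hG hE hF hFs

/-- **THE TWO-GRID DIFFERENCE OF THE FULL WORDS IS A DIFFERENCE OF TWO η-DEFECTS**: `C′ − C = 𝔇(siteForm (q ∘ π) F′ Fs′ X′, siteForm q F Fs X) − 𝔇(siteForm₀′, siteForm₀)` through the
identity transport of the common site lattice. [folklore] -/
theorem sitePertCF_sub {Xf : Type} [Fintype Xf] (q : Xc → Tor M × ι) (π : Xf → Xc) (F : (Xc → ℝ) →ₗ[ℝ] (Tor M × ι → ℝ)) (Fs : (Tor M × ι → ℝ) →ₗ[ℝ] (Xc → ℝ))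
    (F' : (Xf → ℝ) →ₗ[ℝ] (Tor M × ι → ℝ)) (Fs' : (Tor M × ι → ℝ) →ₗ[ℝ] (Xf → ℝ)) (G Xo : (Xc → ℝ) →ₗ[ℝ] (Xc → ℝ)) (G' Xo' : (Xf → ℝ) →ₗ[ℝ] (Xf → ℝ)) :
    sitePertCF M ι (q ∘ π) F' Fs' G' Xo' - sitePertCF M ι q F Fs G Xo =
      idef LinearMap.id LinearMap.id (siteForm (q ∘ π) F' Fs' Xo') (siteForm q F Fs Xo) - idef LinearMap.id LinearMap.id (siteForm (q ∘ π) 0 0 G') (siteForm q 0 0 G) := by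
  unfold sitePertCF idef
  rw [siteForm_zero_zero', siteForm_zero_zero', LinearMap.comp_id, LinearMap.id_comp, LinearMap.comp_id, LinearMap.id_comp]
  abel

/-- ★★ **THE TWO-GRID LETTER, SPECIES LIVE** (fine `(q ∘ π, F′, Fs′, G′, X′)` against coarse `(q, F, Fs, G, X)`, King's pairing `π` with UNIFORM fibres): from the layers' sizes
`X, X′ ≤ B·e^{−δd}`, `G, G′ ≤ β·e^{−δd}`, the species' sizes `F, Fs, F′, Fs′ ≤ diagK r`, the two-grid defects `𝔇^π(X′, X) ≤ m·e^{−δd}`, `𝔇^π(G′, G) ≤ m₀·e^{−δd}` and the species'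
fits `𝔇(F′, F) ≤ diagK o` (through `(τ, 1)`), `𝔇(Fs′, Fs) ≤ diagK o` (through `(1, τ)`): `C′ − C ≤ [2(1 + r)Bc_δ(Bo + m(1 + r)) + 2βc_δm₀]·e^{−(δ∕2)d}` — S2 `hasMaj_idef_siteForm` (species
live) minus the `U ≡ 1` words' defect (S2 at `F ≡ 0`, `X := G`). [cite: Balaban1985BackgroundPropagators, (3.65)–(3.66) p.403 (mechanism); King1986, p.664 (pairing convention)] -/
theorem hasMaj_sitePertCF_sub [NeZero L] [∀ μ, NeZero (M μ)] [Fintype ι] [DecidableEq Xc] {Xf : Type} [Fintype Xf] (k : ℕ) (Msz : ℝ) (q : Xc → Tor M × ι) (π : Xf → Xc) {N : ℕ} (hN : N ≠ 0)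
    (hfib : ∀ x, (fibre π x).card = N) {F : (Xc → ℝ) →ₗ[ℝ] (Tor M × ι → ℝ)} {Fs : (Tor M × ι → ℝ) →ₗ[ℝ] (Xc → ℝ)} {F' : (Xf → ℝ) →ₗ[ℝ] (Tor M × ι → ℝ)}
    {Fs' : (Tor M × ι → ℝ) →ₗ[ℝ] (Xf → ℝ)} {G Xo : (Xc → ℝ) →ₗ[ℝ] (Xc → ℝ)} {G' Xo' : (Xf → ℝ) →ₗ[ℝ] (Xf → ℝ)} {B β m m₀ r o δ : ℝ}
    (hB : 0 ≤ B) (hβ : 0 ≤ β) (hm : 0 ≤ m) (hm₀ : 0 ≤ m₀) (hr : 0 ≤ r) (ho : 0 ≤ o) (hδ : 0 < δ)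
    (hX : HasMaj (BlockNorm.ofBlocks (unitTorusGeoS L k M Msz) (fun x => (q x).1)) (BlockNorm.ofBlocks (unitTorusGeoS L k M Msz) (fun x => (q x).1)) Xo
      (fun y y' => B * Real.exp (-(δ * (unitTorusGeoS L k M Msz).dist y y'))))
    (hX' : HasMaj (BlockNorm.ofBlocks (unitTorusGeoS L k M Msz) (fun x' => (q (π x')).1)) (BlockNorm.ofBlocks (unitTorusGeoS L k M Msz) (fun x' => (q (π x')).1)) Xo'
      (fun y y' => B * Real.exp (-(δ * (unitTorusGeoS L k M Msz).dist y y'))))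
    (hDX : HasMaj (BlockNorm.ofBlocks (unitTorusGeoS L k M Msz) (fun x => (q x).1)) (BlockNorm.ofBlocks (unitTorusGeoS L k M Msz) (fun x' => (q (π x')).1)) (idef (pull π) (pull π) Xo' Xo)
      (fun y y' => m * Real.exp (-(δ * (unitTorusGeoS L k M Msz).dist y y'))))
    (hG : HasMaj (BlockNorm.ofBlocks (unitTorusGeoS L k M Msz) (fun x => (q x).1)) (BlockNorm.ofBlocks (unitTorusGeoS L k M Msz) (fun x => (q x).1)) G
      (fun y y' => β * Real.exp (-(δ * (unitTorusGeoS L k M Msz).dist y y'))))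
    (hG' : HasMaj (BlockNorm.ofBlocks (unitTorusGeoS L k M Msz) (fun x' => (q (π x')).1)) (BlockNorm.ofBlocks (unitTorusGeoS L k M Msz) (fun x' => (q (π x')).1)) G'
      (fun y y' => β * Real.exp (-(δ * (unitTorusGeoS L k M Msz).dist y y'))))
    (hDG : HasMaj (BlockNorm.ofBlocks (unitTorusGeoS L k M Msz) (fun x => (q x).1)) (BlockNorm.ofBlocks (unitTorusGeoS L k M Msz) (fun x' => (q (π x')).1)) (idef (pull π) (pull π) G' G)
      (fun y y' => m₀ * Real.exp (-(δ * (unitTorusGeoS L k M Msz).dist y y'))))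
    (hFs : HasMaj (BlockNorm.ofBlocks (unitTorusGeoS L k M Msz) (fun p : Tor M × ι => p.1)) (BlockNorm.ofBlocks (unitTorusGeoS L k M Msz) (fun x => (q x).1)) Fs (diagK fun _ => r))
    (hF' : HasMaj (BlockNorm.ofBlocks (unitTorusGeoS L k M Msz) (fun x' => (q (π x')).1)) (BlockNorm.ofBlocks (unitTorusGeoS L k M Msz) (fun p : Tor M × ι => p.1)) F' (diagK fun _ => r))
    (hFs' : HasMaj (BlockNorm.ofBlocks (unitTorusGeoS L k M Msz) (fun p : Tor M × ι => p.1)) (BlockNorm.ofBlocks (unitTorusGeoS L k M Msz) (fun x' => (q (π x')).1)) Fs' (diagK fun _ => r))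
    (hDF : HasMaj (BlockNorm.ofBlocks (unitTorusGeoS L k M Msz) (fun x => (q x).1)) (BlockNorm.ofBlocks (unitTorusGeoS L k M Msz) (fun p : Tor M × ι => p.1)) (idef (pull π) LinearMap.id F' F)
      (diagK fun _ => o))
    (hDFs : HasMaj (BlockNorm.ofBlocks (unitTorusGeoS L k M Msz) (fun p : Tor M × ι => p.1)) (BlockNorm.ofBlocks (unitTorusGeoS L k M Msz) (fun x' => (q (π x')).1)) (idef LinearMap.id (pull π) Fs' Fs)
      (diagK fun _ => o)) :
    HasMaj (BlockNorm.ofBlocks (unitTorusGeoS L k M Msz) (fun p : Tor M × ι => p.1)) (BlockNorm.ofBlocks (unitTorusGeoS L k M Msz) (fun p : Tor M × ι => p.1))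
      (sitePertCF M ι (q ∘ π) F' Fs' G' Xo' - sitePertCF M ι q F Fs G Xo)
      (fun y y' => (2 * (1 + r) * B * latticeConst (d + 1) (δ / 2) * (B * o + m * (1 + r)) + 2 * latticeConst (d + 1) (δ / 2) * (β * m₀)) *
        Real.exp (-(δ / 2 * (unitTorusGeoS L k M Msz).dist y y'))) := by
  have hK : 0 ≤ latticeConst (d + 1) (δ / 2) := latticeConst_nonneg _ (by positivity)
  have htri := triangle254_unitTorusGeo L k M
  have hrow := rowSum_unitTorusGeo L k M (half_pos hδ)
  have hd : ∀ a b : (unitTorusGeoS L k M Msz).Site, 0 ≤ (unitTorusGeoS L k M Msz).dist a b := fun a b => tdistT_nonneg M a b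
  have z1 : HasMaj (BlockNorm.ofBlocks (unitTorusGeoS L k M Msz) (fun p : Tor M × ι => p.1)) (BlockNorm.ofBlocks (unitTorusGeoS L k M Msz) (fun x => (q x).1))
      (0 : (Tor M × ι → ℝ) →ₗ[ℝ] (Xc → ℝ)) (diagK fun _ => 0) := (hasMaj_zero _ _).mono fun _ _ => diagK_nonneg (fun _ => le_rfl) _ _
  have z2 : HasMaj (BlockNorm.ofBlocks (unitTorusGeoS L k M Msz) (fun x' => (q (π x')).1)) (BlockNorm.ofBlocks (unitTorusGeoS L k M Msz) (fun p : Tor M × ι => p.1))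
      (0 : (Xf → ℝ) →ₗ[ℝ] (Tor M × ι → ℝ)) (diagK fun _ => 0) := (hasMaj_zero _ _).mono fun _ _ => diagK_nonneg (fun _ => le_rfl) _ _
  have z3 : HasMaj (BlockNorm.ofBlocks (unitTorusGeoS L k M Msz) (fun p : Tor M × ι => p.1)) (BlockNorm.ofBlocks (unitTorusGeoS L k M Msz) (fun x' => (q (π x')).1))
      (0 : (Tor M × ι → ℝ) →ₗ[ℝ] (Xf → ℝ)) (diagK fun _ => 0) := (hasMaj_zero _ _).mono fun _ _ => diagK_nonneg (fun _ => le_rfl) _ _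
  have z4 : HasMaj (BlockNorm.ofBlocks (unitTorusGeoS L k M Msz) (fun x => (q x).1)) (BlockNorm.ofBlocks (unitTorusGeoS L k M Msz) (fun p : Tor M × ι => p.1))
      (idef (pull π) LinearMap.id (0 : (Xf → ℝ) →ₗ[ℝ] (Tor M × ι → ℝ)) (0 : (Xc → ℝ) →ₗ[ℝ] (Tor M × ι → ℝ))) (diagK fun _ => 0) := by
    rw [idef_zero_zero]; exact (hasMaj_zero _ _).mono fun _ _ => diagK_nonneg (fun _ => le_rfl) _ _
  have z5 : HasMaj (BlockNorm.ofBlocks (unitTorusGeoS L k M Msz) (fun p : Tor M × ι => p.1)) (BlockNorm.ofBlocks (unitTorusGeoS L k M Msz) (fun x' => (q (π x')).1))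
      (idef LinearMap.id (pull π) (0 : (Tor M × ι → ℝ) →ₗ[ℝ] (Xf → ℝ)) (0 : (Tor M × ι → ℝ) →ₗ[ℝ] (Xc → ℝ))) (diagK fun _ => 0) := by
    rw [idef_zero_zero]; exact (hasMaj_zero _ _).mono fun _ _ => diagK_nonneg (fun _ => le_rfl) _ _
  have h1 := hasMaj_idef_siteForm (g := unitTorusGeoS L k M Msz) (σ := δ / 2) (cr := latticeConst (d + 1) (δ / 2)) htri hd hrow (by positivity)
    (fun x => (q x).1) (fun p : Tor M × ι => p.1) q π (fun _ => rfl) hN hfib hB hm hr ho (by positivity : (0 : ℝ) ≤ δ / 2) (by linarith) hX hX' hDX hFs hF' hFs' hDF hDFs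
  have h2 := hasMaj_idef_siteForm (g := unitTorusGeoS L k M Msz) (σ := δ / 2) (cr := latticeConst (d + 1) (δ / 2)) htri hd hrow (by positivity)
    (fun x => (q x).1) (fun p : Tor M × ι => p.1) q π (fun _ => rfl) hN hfib hβ hm₀ le_rfl le_rfl (by positivity : (0 : ℝ) ≤ δ / 2) (by linarith) hG hG' hDG z1 z2 z3 z4 z5
  rw [sitePertCF_sub]
  refine (h1.sub h2).mono fun y y' => le_of_eq ?_
  ring


end WordsCF

/-! ## §2 ★★ The three letters of part XXI's coloured socket from block letters, averaging species live, read at size -/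

section LettersCF

variable [NeZero L] {I : Type} (ι : Type) [Fintype ι] [DecidableEq ι] (Mn : I → Fin (d + 1) → ℕ) [hMn0 : ∀ i μ, NeZero (Mn i μ)] (kk : I → ℕ) (Msz : I → ℝ)
  (Xc Xf : I → Type) [∀ i, Fintype (Xc i)] [∀ i, DecidableEq (Xc i)] [∀ i, Fintype (Xf i)] (q : ∀ i, Xc i → Tor (Mn i) × ι) (π : ∀ i, Xf i → Xc i)
  (Bc Bf : I → B9.Backgrounds) (avg : ∀ i, (Bf i).Cfg → (Bc i).Cfg)
  (Gc : ∀ i, (Xc i → ℝ) →ₗ[ℝ] (Xc i → ℝ)) (Gf : ∀ i, (Xf i → ℝ) →ₗ[ℝ] (Xf i → ℝ))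
  (Xco : ∀ i, (Bc i).Cfg → (Xc i → ℝ) →ₗ[ℝ] (Xc i → ℝ)) (Xfo : ∀ i, (Bf i).Cfg → (Xf i → ℝ) →ₗ[ℝ] (Xf i → ℝ))
  (Fc : ∀ i, (Bc i).Cfg → (Xc i → ℝ) →ₗ[ℝ] (Tor (Mn i) × ι → ℝ)) (Fsc : ∀ i, (Bc i).Cfg → (Tor (Mn i) × ι → ℝ) →ₗ[ℝ] (Xc i → ℝ))
  (Ff : ∀ i, (Bf i).Cfg → (Xf i → ℝ) →ₗ[ℝ] (Tor (Mn i) × ι → ℝ)) (Fsf : ∀ i, (Bf i).Cfg → (Tor (Mn i) × ι → ℝ) →ₗ[ℝ] (Xf i → ℝ))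

/-- ★★★ **THE SITE LETTERS FROM BLOCK LETTERS, AVERAGING SPECIES LIVE.**  Part V's `siteLetters_of_dressedLetters` with the species `Fc∕Fsc` (coarse run, at `Ū`) and `Ff∕Fsf` (fine run,
at `U`) carrying SIZES `≤ diagK (r₀α₀)` and FITS `𝔇(F′, F) ≤ diagK (o₀·r_i)`, `𝔇(Fs′, Fs) ≤ diagK (o₀·r_i)` (`r_i = (L^{k i})^{−γ_P}`) under `Reg335 c₃₅ α₀ U`, `α₀ ≤ a₁` — the three
letters of parts II∕IV for `Pf i U := siteEntries (sitePert365F (q i ∘ π i) (Ff i U) (Fsf i U) (Gf i) (Xfo i U))`, `Pc i V := siteEntries (sitePert365F (q i) (Fc i V) (Fsc i V) (Gc i) (Xco i V))`,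
constants `(δ∕2, (r₀B²(1 + r₀a₁) + B²r₀ + (B+β)ε)c_δ + 1, 2(1 + r₀a₁)Bc_δ(Bo₀ + m(1 + r₀a₁)) + 2c_δβm₀ + 1, a₁)`. [cite: Balaban1985BackgroundPropagators, (3.58) p.402, (3.65)–(3.67)
p.403 (mechanism); King1986, p.664 (pairing)] -/
theorem siteLettersCF_of_sizedDressedLetters (c35 : ℝ) {γP : ℝ} (hMsz : ∀ i, 0 ≤ Msz i)
    (hfib : ∀ i, ∃ N : ℕ, N ≠ 0 ∧ ∀ x, (fibre (π i) x).card = N)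
    (hL : ∃ β B ε m m₀ r₀ o₀ δ a₁ : ℝ, 0 ≤ β ∧ 0 ≤ B ∧ 0 < ε ∧ 0 ≤ m ∧ 0 ≤ m₀ ∧ 0 ≤ r₀ ∧ 0 ≤ o₀ ∧ 0 < δ ∧ 0 < a₁ ∧ ∀ i : I,
      HasMaj (BlockNorm.ofBlocks (unitTorusGeoS L (kk i) (Mn i) (Msz i)) (fun x => (q i x).1)) (BlockNorm.ofBlocks (unitTorusGeoS L (kk i) (Mn i) (Msz i)) (fun x => (q i x).1)) (Gc i)
        (fun y y' => β * Real.exp (-(δ * (unitTorusGeoS L (kk i) (Mn i) (Msz i)).dist y y'))) ∧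
      HasMaj (BlockNorm.ofBlocks (unitTorusGeoS L (kk i) (Mn i) (Msz i)) (fun x' => (q i (π i x')).1)) (BlockNorm.ofBlocks (unitTorusGeoS L (kk i) (Mn i) (Msz i)) (fun x' => (q i (π i x')).1)) (Gf i)
        (fun y y' => β * Real.exp (-(δ * (unitTorusGeoS L (kk i) (Mn i) (Msz i)).dist y y'))) ∧
      HasMaj (BlockNorm.ofBlocks (unitTorusGeoS L (kk i) (Mn i) (Msz i)) (fun x => (q i x).1)) (BlockNorm.ofBlocks (unitTorusGeoS L (kk i) (Mn i) (Msz i)) (fun x' => (q i (π i x')).1))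
        (idef (pull (π i)) (pull (π i)) (Gf i) (Gc i)) (fun y y' => m₀ * ((L : ℝ) ^ kk i) ^ (-γP) * Real.exp (-(δ * (unitTorusGeoS L (kk i) (Mn i) (Msz i)).dist y y'))) ∧
      ∀ (α₀ : ℝ), 0 < α₀ → Msz i * α₀ ≤ a₁ → ∀ U : (Bf i).Cfg, (Bf i).Reg335 c35 α₀ U →
        HasMaj (BlockNorm.ofBlocks (unitTorusGeoS L (kk i) (Mn i) (Msz i)) (fun x => (q i x).1)) (BlockNorm.ofBlocks (unitTorusGeoS L (kk i) (Mn i) (Msz i)) (fun x => (q i x).1)) (Xco i (avg i U))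
          (fun y y' => B * Real.exp (-(δ * (unitTorusGeoS L (kk i) (Mn i) (Msz i)).dist y y'))) ∧
        HasMaj (BlockNorm.ofBlocks (unitTorusGeoS L (kk i) (Mn i) (Msz i)) (fun x' => (q i (π i x')).1)) (BlockNorm.ofBlocks (unitTorusGeoS L (kk i) (Mn i) (Msz i)) (fun x' => (q i (π i x')).1)) (Xfo i U)
          (fun y y' => B * Real.exp (-(δ * (unitTorusGeoS L (kk i) (Mn i) (Msz i)).dist y y'))) ∧
        HasMaj (BlockNorm.ofBlocks (unitTorusGeoS L (kk i) (Mn i) (Msz i)) (fun x => (q i x).1)) (BlockNorm.ofBlocks (unitTorusGeoS L (kk i) (Mn i) (Msz i)) (fun x => (q i x).1)) (Xco i (avg i U) - Gc i)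
          (fun y y' => ε * (Msz i * α₀) * Real.exp (-(δ * (unitTorusGeoS L (kk i) (Mn i) (Msz i)).dist y y'))) ∧
        HasMaj (BlockNorm.ofBlocks (unitTorusGeoS L (kk i) (Mn i) (Msz i)) (fun x' => (q i (π i x')).1)) (BlockNorm.ofBlocks (unitTorusGeoS L (kk i) (Mn i) (Msz i)) (fun x' => (q i (π i x')).1))
          (Xfo i U - Gf i) (fun y y' => ε * (Msz i * α₀) * Real.exp (-(δ * (unitTorusGeoS L (kk i) (Mn i) (Msz i)).dist y y'))) ∧
        HasMaj (BlockNorm.ofBlocks (unitTorusGeoS L (kk i) (Mn i) (Msz i)) (fun x => (q i x).1)) (BlockNorm.ofBlocks (unitTorusGeoS L (kk i) (Mn i) (Msz i)) (fun x' => (q i (π i x')).1))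
          (idef (pull (π i)) (pull (π i)) (Xfo i U) (Xco i (avg i U)))
          (fun y y' => m * ((L : ℝ) ^ kk i) ^ (-γP) * Real.exp (-(δ * (unitTorusGeoS L (kk i) (Mn i) (Msz i)).dist y y'))) ∧
        HasMaj (BlockNorm.ofBlocks (unitTorusGeoS L (kk i) (Mn i) (Msz i)) (fun x => (q i x).1)) (BlockNorm.ofBlocks (unitTorusGeoS L (kk i) (Mn i) (Msz i)) (fun p : Tor (Mn i) × ι => p.1))
          (Fc i (avg i U)) (diagK fun _ => r₀ * (Msz i * α₀)) ∧
        HasMaj (BlockNorm.ofBlocks (unitTorusGeoS L (kk i) (Mn i) (Msz i)) (fun p : Tor (Mn i) × ι => p.1)) (BlockNorm.ofBlocks (unitTorusGeoS L (kk i) (Mn i) (Msz i)) (fun x => (q i x).1))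
          (Fsc i (avg i U)) (diagK fun _ => r₀ * (Msz i * α₀)) ∧
        HasMaj (BlockNorm.ofBlocks (unitTorusGeoS L (kk i) (Mn i) (Msz i)) (fun x' => (q i (π i x')).1)) (BlockNorm.ofBlocks (unitTorusGeoS L (kk i) (Mn i) (Msz i)) (fun p : Tor (Mn i) × ι => p.1))
          (Ff i U) (diagK fun _ => r₀ * (Msz i * α₀)) ∧
        HasMaj (BlockNorm.ofBlocks (unitTorusGeoS L (kk i) (Mn i) (Msz i)) (fun p : Tor (Mn i) × ι => p.1)) (BlockNorm.ofBlocks (unitTorusGeoS L (kk i) (Mn i) (Msz i)) (fun x' => (q i (π i x')).1))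
          (Fsf i U) (diagK fun _ => r₀ * (Msz i * α₀)) ∧
        HasMaj (BlockNorm.ofBlocks (unitTorusGeoS L (kk i) (Mn i) (Msz i)) (fun x => (q i x).1)) (BlockNorm.ofBlocks (unitTorusGeoS L (kk i) (Mn i) (Msz i)) (fun p : Tor (Mn i) × ι => p.1))
          (idef (pull (π i)) LinearMap.id (Ff i U) (Fc i (avg i U))) (diagK fun _ => o₀ * ((L : ℝ) ^ kk i) ^ (-γP)) ∧
        HasMaj (BlockNorm.ofBlocks (unitTorusGeoS L (kk i) (Mn i) (Msz i)) (fun p : Tor (Mn i) × ι => p.1)) (BlockNorm.ofBlocks (unitTorusGeoS L (kk i) (Mn i) (Msz i)) (fun x' => (q i (π i x')).1))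
          (idef LinearMap.id (pull (π i)) (Fsf i U) (Fsc i (avg i U))) (diagK fun _ => o₀ * ((L : ℝ) ^ kk i) ^ (-γP))) :
    ∃ δP ζ τ a₁ : ℝ, 0 < δP ∧ 0 < ζ ∧ 0 < τ ∧ 0 < a₁ ∧
      ∀ (i : I) (α₀ : ℝ), 0 < α₀ → Msz i * α₀ ≤ a₁ → ∀ U : (Bf i).Cfg, (Bf i).Reg335 c35 α₀ U →
        (∀ p p' : Idx (Mn i) × ι, |siteEntriesC (Mn i) ι (sitePertCF (Mn i) ι (q i) (Fc i (avg i U)) (Fsc i (avg i U)) (Gc i) (Xco i (avg i U))) p p'|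
            ≤ ζ * (Msz i * α₀) * Real.exp (-(δP * tdist (Mn i) p.1 p'.1))) ∧
        (∀ p p' : Idx (Mn i) × ι, |siteEntriesC (Mn i) ι (sitePertCF (Mn i) ι (q i ∘ π i) (Ff i U) (Fsf i U) (Gf i) (Xfo i U)) p p'| ≤ ζ * (Msz i * α₀) * Real.exp (-(δP * tdist (Mn i) p.1 p'.1))) ∧
        (∀ p p' : Idx (Mn i) × ι, |siteEntriesC (Mn i) ι (sitePertCF (Mn i) ι (q i ∘ π i) (Ff i U) (Fsf i U) (Gf i) (Xfo i U)) p p'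
              - siteEntriesC (Mn i) ι (sitePertCF (Mn i) ι (q i) (Fc i (avg i U)) (Fsc i (avg i U)) (Gc i) (Xco i (avg i U))) p p'|
            ≤ τ * ((L : ℝ) ^ kk i) ^ (-γP) * Real.exp (-(δP * tdist (Mn i) p.1 p'.1))) := by
  obtain ⟨β, B, ε, m, m₀, r₀, o₀, δ, a₁, hβ, hB, hε, hm, hm₀, hr₀, ho₀, hδ, ha₁, H⟩ := hL
  have hLr : (0 : ℝ) ≤ (L : ℝ) := Nat.cast_nonneg _
  obtain ⟨c, hcdef⟩ : ∃ c : ℝ, c = latticeConst (d + 1) (δ / 2) := ⟨_, rfl⟩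
  have hc : 0 ≤ c := hcdef ▸ latticeConst_nonneg _ (by positivity)
  obtain ⟨R, hRdef⟩ : ∃ R : ℝ, R = r₀ * a₁ := ⟨_, rfl⟩
  have hR : 0 ≤ R := hRdef ▸ mul_nonneg hr₀ ha₁.le
  refine ⟨δ / 2, (r₀ * (B * B * (1 + R)) + B * B * r₀ + (B + β) * ε) * c + 1, (2 * (1 + R) * B * c * (B * o₀ + m * (1 + R)) + 2 * c * (β * m₀)) + 1, a₁, half_pos hδ,
    by positivity, by positivity, ha₁, fun i α₀ hα₀ hαa₁ U hreg => ?_⟩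
  obtain ⟨hGc, hGf, hDG, HU⟩ := H i
  obtain ⟨hXc, hXf, hEc, hEf, hDX, hFc, hFsc, hFf, hFsf, hDF, hDFs⟩ := HU α₀ hα₀ hαa₁ U hreg
  have hs0 : 0 ≤ Msz i * α₀ := mul_nonneg (hMsz i) hα₀.le
  obtain ⟨N, hN, hfibi⟩ := hfib i
  have hr : 0 ≤ ((L : ℝ) ^ kk i) ^ (-γP) := Real.rpow_nonneg (pow_nonneg hLr _) _
  have hrα : 0 ≤ r₀ * (Msz i * α₀) := mul_nonneg hr₀ hs0
  have hrR : r₀ * (Msz i * α₀) ≤ R := hRdef ▸ mul_le_mul_of_nonneg_left hαa₁ hr₀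
  -- the size letters (S2 `hasMaj_siteC`)
  have hPc := hasMaj_sitePertCF (L := L) (Mn i) ι (kk i) (Msz i) (q i) hB hβ (mul_nonneg hε.le hs0) hrα hδ hXc hGc hEc hFc hFsc
  have hPf := hasMaj_sitePertCF (L := L) (Mn i) ι (kk i) (Msz i) (q i ∘ π i) hB hβ (mul_nonneg hε.le hs0) hrα hδ hXf hGf hEf hFf hFsf
  -- the two-grid letter (S2 `hasMaj_idef_siteForm` with the fits live)
  have hPP := hasMaj_sitePertCF_sub (L := L) (Mn i) ι (kk i) (Msz i) (q i) (π i) hN hfibi hB hβ (mul_nonneg hm hr) (mul_nonneg hm₀ hr) hrα (mul_nonneg ho₀ hr) hδ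
    hXc hXf hDX hGc hGf hDG hFsc hFf hFsf hDF hDFs
  have key : ∀ p p' : Idx (Mn i) × ι, (r₀ * (Msz i * α₀) * (B * B * (1 + r₀ * (Msz i * α₀))) + B * B * (r₀ * (Msz i * α₀)) + (B + β) * (ε * (Msz i * α₀))) * c
      ≤ ((r₀ * (B * B * (1 + R)) + B * B * r₀ + (B + β) * ε) * c + 1) * (Msz i * α₀) := fun _ _ =>
    sitePertF_sizeConst_le (β := β) (ε := ε) hr₀ hs0 hB hc hrR
  refine ⟨fun p p' => ?_, fun p p' => ?_, fun p p' => ?_⟩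
  · refine (abs_siteEntriesC_le_of_hasMaj (L := L) (Mn i) ι (kk i) (Msz i) hPc p p').trans ?_
    rw [← hcdef]
    exact mul_le_mul_of_nonneg_right (key p p') (Real.exp_nonneg _)
  · refine (abs_siteEntriesC_le_of_hasMaj (L := L) (Mn i) ι (kk i) (Msz i) hPf p p').trans ?_
    rw [← hcdef]
    exact mul_le_mul_of_nonneg_right (key p p') (Real.exp_nonneg _)
  · rw [← Matrix.sub_apply, ← siteEntriesC_sub]
    refine (abs_siteEntriesC_le_of_hasMaj (L := L) (Mn i) ι (kk i) (Msz i) hPP p p').trans ?_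
    rw [← hcdef]
    have hE := Real.exp_nonneg (-(δ / 2 * tdist (Mn i) p.1 p'.1))
    exact mul_le_mul_of_nonneg_right (sitePertF_fitConst_le (β := β) (m₀ := m₀) hr₀ hs0 hB hc ho₀ hm hr hrR) hE

end LettersCF

end Summit.QuantumFields.YangMills.BalabanUVNodes.N15.SiteLayerBg

end
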